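/-
Copyright (c) 2026 the pub-hodgecm-mathlib formalisation cell (harness21).  Prover seat hodgecm-mathlib-LH4-p18 (g3), Track A «FOUR-FRAME» hand on VALVE loan to
Track B «K2-LIT», #184♮ = hLiu418 = `stmt-HodgeConjecture-24832`; socket #41, KIND 1 (K1-b♮ LINE TERM), organ (K1b-W) «KIND W AT `n := 1` FOR THE PULLED-BACK FAMILY»
— LEAD F0P6-plan (g14) BATCH #100 (2) (2026-09-04T22:42:24Z), line lead K2Liu-p14 (g4) FILE CUT 22:32:01Z ∕ LINE WORD #1 22:42:47Z, K1 desk F0P2-p11 (g2); file (KW1-pkg).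
THEOREMS ONLY (no `def`, no `instance`, no notation, no named-fact hypothesis, no `sorry`).
-/
import Summits.HodgeConjecture.HodgeConjecture.Theorems.K2LiuKindOneLineWhittakerHolomorphy     -- ★ p862650 (KW1-a, K2Liu-p14): `differentiableOn_whittakerDelta_line_of_envelope`
import Summits.HodgeConjecture.HodgeConjecture.Theorems.K2LiuSiegelIntertwiningScalarGL1        -- ★ O41.6: `norm_valueAtUniformizer_le_one` (+ ★ `differentiableOn_∕hasProd_partialStandardL_singleton`)
import Summits.HodgeConjecture.HodgeConjecture.Theorems.K2LiuSiegelEisensteinKindWInstance     -- ★ p862446 (K2E4-p10): §1.3 `hsupp_of_local` (generic `ι X n N`)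
import Summits.HodgeConjecture.HodgeConjecture.Theorems.K2LiuSiegelEisensteinKindWDecay        -- ★ p862527 (K2E4-p10): `hdec_of_letters` (generic `ι X n N`)
import HarnessLib

/-!
# Crux `HLiu418`, socket #41, KIND 1 ∕ organ (K1b-W), file (KW1-pkg) — `K2LiuKindOneLineWhittakerPackage`: THE ∃-PACKAGE HEAD OF KIND W AT `n := 1`,
# STAGE 1 «THE LETTERS GIVE THE BLOCK» — and the organ's KEY FACT made formal: at `n = 1`, inner parameter `s + ½`, the `T`-part is holomorphic on ALL of `{0 < re s}`
# because the rank-one Whittaker integral converges there («continued = integral»)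

Cell `hodgecm-mathlib`, crux item hLiu418 = `stmt-HodgeConjecture-24832` (helper lane `--supports … --as helper`, count-neutral), route of record `HCCMUnconditional`;
squad K2 ∕ K2Liu, road `K2_Liu`, socket #41 `sig_K2LiuSiegelEisensteinContinuation`.  The TOP of record (★ ed. 16 `K2LiuSiegelEisensteinContinuationTopSixteen`) carries KIND W
as the by-value block `(A U hEuler hAd τ hτ NW hdec {CW κ} hCW hκ hsupp)` (:200–220) and the K1-b♮ LINE TERM as `(Ebc hEbd hEbc τb hτb Nb hdecb {Cb κb} hCb hκb hsuppb)` (:159–180);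
by the K1 desk's road (F0P2-p11 memo `CENSUS-K1-DealTable` §2: (T4-α) ★ p862495 → (T4-β) → (K1b-W) → (K1b-♮) assembly) `Ebc S s h` is a constant times the RANK-ONE twisted big-cell
integral `W⁽¹⁾_μ(Φ^{(p₀,g)}_s)(1)` on the doubled LINE `H₁` (datum `e₁ : Fin N₁ × Fin M₁ ≃ Fin 1`) of the translated corner family `Φ^{(p₀,g)}_s(y) = f_s(p₀ · blkD(1,y) · g)`
(★ (KW1-e) `K2LiuKindOneLineWhittakerTranslate`), a Siegel family of `I⁽¹⁾(s + ½, χ)` indexed by the translate `g ∈ H(𝔸)` — line lead's CURRENCY RULING (LINE WORD #1 (1)):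
evaluation point `1`, every letter indexed by the translate, heights read on the BIG group.  THIS FILE is the organ's LAST file, the ∃-head, written FIRST-STAGE and
CURRENCY-FREE: the family is an ABSTRACT `X`-indexed family of line families `Φ : X → ℂ → H₁(𝔸) → ℂ` with an ABSTRACT height reading `ht : X → GL_N(𝔸_L)` (the assembly
reads `X := H(𝔸)`, `ht := (↑)`, `N := n + n`; a consumer working on `H₁` itself reads `X := H₁(𝔸)`, `N := 1 + 1`), and the sibling heads enter BY VALUE:
* §1 **THE KEY FACT** `differentiableOn_linePart_of_euler` — for ONE index `μ` and ONE point `x`: if `s ↦ W s` is holomorphic on `{0 < re s}` (★ (KW1-a) by name, or any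
  source), `W s = A s · (L^{U}(2(s+½)+1, ε_{L∕L⁺}))⁻¹` there (the ONE-FACTOR rank-one Euler identity of (KW1-b), LH7-p08 (g2) SIG §2, `b₁(s′) = L^U(2s′+1, ε)`), then
  `s ↦ A s` is holomorphic on `{0 < re s}` — because `L^U(2s+2, ε)` is an absolutely convergent Euler product there (★ `differentiableOn_partialStandardL_singleton`,
  ★ `hasProd_partialStandardL_singleton`: holomorphic AND zero-free on `re > 1`, read at `2 re s + 2 > 1`), so `A = W · L^U` on the whole window.  NO continuation.
  `differentiableOn_linePart` — the same for an index-and-point family with the KIND-W convention `hdet0` (`A μ s x = 0` at `det μ = 0`, where no Euler identity is asked).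
* §2 **THE PACKAGE FROM THE TOP-SHAPE LETTERS** `exists_kindW_line_letters_of_letters` — Euler data `(A₁, U₁, hEuler₁)` BY VALUE ((KW1-b) head read through `Φ` at `s′ = s + ½`,
  window `{0 < re s}` = Godement's `{½ < re s′}`), `hdet0`, the holomorphy of `W⁽¹⁾_μ(Φ_x)(1)` BY VALUE (`hW₁`, ★ (KW1-a)), and the three (W3) letters BY VALUE in the TOP's
  shapes — `(τ₁, hτ₁)`, `(NW₁, hdec₁)` ((KW1-d) head, LH4-p09 (g10)), `(CW₁, κ₁, hsupp₁)` ((KW1-c) head, K2E3-p26 (g2)) — ⟹ THE BLOCK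
  `∃ A₁ U₁, hEuler₁ ∧ hAd₁ ∧ ∃ τ₁ NW₁, hτ₁ ∧ hdec₁ ∧ ∃ CW₁ κ₁, 0 < CW₁ ∧ 0 ≤ κ₁ ∧ hsupp₁` (conjuncts = TOP :200–220 in order, at `n := 1`, ONE Euler factor, point `1`,
  index `x : X`, heights `adelicHeightGL N L (ht x)`), `hAd₁` DISCHARGED by §1.  `exists_kindW_line_letters_of_envelope` — the same with `hW₁` discharged BY NAME from the
  four letters of ★ (KW1-a) `differentiableOn_whittakerDelta_line_of_envelope` (sections at `s + ½`, holomorphy, continuity, vertical-strip envelope — exactly (KW1-e)'s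
  ★ `isSiegelDeltaSection_cornerTranslate` ∕ `differentiableOn_∕continuous_cornerTranslate` ∕ `norm_cornerTranslate_eq` + ★ (KW1-a) §2 (c) for the corner family).
* §3 **THE PACKAGE FROM THE LOCAL LETTERS** `exists_kindW_line_letters_of_localLetters` — as §2 but with the (W3) letters in the LOCAL currencies of ★ `hsupp_of_local`
  ((S-loc): `A₁ μ s x ≠ 0 ⇒ ∀ w, ∃ m, q_w^m ≤ q_w^{δ_w}·H_w(ht x)^k ∧ |μ₀₀|_w ≤ exp m`) and ★ `hdec_of_letters` ((D-loc): the TOP's decay shape at `τ₁ μ := ‖(ι_∞ μ_{ij})_{ij}‖`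
  TIMES the archimedean defect `∏_{w∣∞}(1 + |det μ|_w⁻¹)^{N′}`), both ★ generic in `(ι, X, n, N)` and read here at `n := 1`, `ι :=` the line indices, `mat := (↑)` — the
  twin of ★ `K2LiuSiegelEisensteinKindWPackage.exists_kindW_letters_of_globalLetters` (the `n = 2` STAGE 1) one rank down (`hτ₁ := le_rfl`).
STAGE 2 (edition 2, after (KW1-b)(b2)(c)(d)(e2)(e3) are ★): the head for the CONCRETE corner family with `A₁ := kindWPart` at `e₁` — `hG` discharged by ★ O41.3
`integrable_weylDelta_mul` (`½ < re s′`), the global seam (c3) by ★ `K2LiuSiegelEisensteinKindWPartFubini.jointWhittaker_eq_sum_mul_prod_of_sum_tensor` at `e₁`.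
[MoeglinWaldspurger1995, II.1.7, IV.1.9] [KudlaRallis1994, §1–§2] [Tan1999, §3–§4] [Shimura1997, §18.4 Prop. 18.14] [Liu2011, §2A (2-2)] [BorelJacquet1979, §1.2].
HONEST LABEL.  Count-neutral helper, closes no socket; every sibling head enters BY VALUE: `HC_CM` is proved only modulo the 7 printed citations (2 remaining named inputs:
hLiu418 = `stmt-HodgeConjecture-24832`, h413 = `stmt-HodgeConjecture-24833`) until rung 0 closes.

## References
* [MoeglinWaldspurger1995] C. Mœglin, J.-L. Waldspurger, *Spectral decomposition and Eisenstein series*, CUP (1995): II.1.7 (Whittaker ∕ intertwining integrals converge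
  absolutely on Godement's half-plane), IV.1.9 (holomorphy of Fourier coefficients).
* [KudlaRallis1994] S. Kudla, S. Rallis, *A regularized Siegel–Weil formula: the first term identity*, Ann. of Math. 140 (1994): §1–§2 (`W_β(g, s, Φ)`, Euler factorisation
  off a finite set, the normalising factor `b_n(s)`).
* [Tan1999] V. Tan, *Poles of Siegel Eisenstein series on U(n,n)*, Canad. J. Math. 51 (1999): §3 (Fourier coefficients, `n = 1`), §4 Prop. 4.8 (support ∕ denominators).
* [Liu2011] Y. Liu, *Arithmetic theta lifting and L-derivatives for unitary groups, I*, Algebra Number Theory 5 (2011): §2A (2-2) (`b₁(s) = L(2s+1, χ|·|_{𝔸_{F}})` at `m = 1`).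
* [Shimura1997] G. Shimura, *Euler Products and Eisenstein Series*, CBMS 93 (1997): §18.4 Prop. 18.14 (rapid decay of the archimedean confluent factor).
* [BorelJacquet1979] A. Borel, H. Jacquet, *Automorphic forms and automorphic representations*, PSPM 33.1 (1979): §1.2 (heights on adelic groups).
-/

set_option autoImplicit false
set_option linter.dupNamespace false -- the mandated namespace repeats `HodgeConjecture.HodgeConjecture`

noncomputable section

open scoped Matrix NNReal
-- `Classical` is needed to see the Mathlib normed-ring instances on `mixedSpace L` (note H5 of ★ `AdelicGLnGlue`; as the TOP's `hτ`)
open scoped Classical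
open NumberField IsDedekindDomain MeasureTheory

namespace Summit.HodgeConjecture.HodgeConjecture.Cruxes.HLiu418.K2LiuKindOneLineWhittakerPackage

open Literature.NumberTheory.Automorphic Literature.NumberTheory.GaloisRepresentations Literature.NumberTheory.LFunctions
open Literature.NumberTheory.GelbartRogawski1991 Literature.NumberTheory.GelbartRogawski1991.GRConstruction
open Literature.NumberTheory.K2Lit.SiegelDoubled
open Summit.HodgeConjecture.HodgeConjecture.Cruxes.HLiu418.K2LiuSiegelUnipotentFourierDefs
open Summit.HodgeConjecture.HodgeConjecture.Cruxes.H413.F0P2wPartialDedekindZetaPole (differentiableOn_partialStandardL_singleton hasProd_partialStandardL_singleton)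
open Summit.HodgeConjecture.HodgeConjecture.Cruxes.HLiu418.K2LiuSiegelIntertwiningScalarGL1 (norm_valueAtUniformizer_le_one)
open Summit.HodgeConjecture.HodgeConjecture.Cruxes.HLiu418.K2LiuKindOneLineWhittakerHolomorphy (differentiableOn_whittakerDelta_line_of_envelope)
open Summit.HodgeConjecture.HodgeConjecture.Cruxes.HLiu418.K2LiuSiegelEisensteinKindWInstance (hsupp_of_local)
open Summit.HodgeConjecture.HodgeConjecture.Cruxes.HLiu418.K2LiuSiegelEisensteinKindWDecay (hdec_of_letters)

/-! ## §1 The KEY FACT: at `n = 1`, inner parameter `s + ½`, the `T`-part is holomorphic on the whole window `{0 < re s}` -/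

section KeyFact

variable (L : Type) [Field L] [NumberField L] [IsCMField L]

/-- `re (2(s + ½) + 1) = 2 re s + 2`. [folklore] -/
theorem re_lineShift (s : ℂ) : (2 * (s + 1 / 2) + 1).re = 2 * s.re + 2 := by
  simp [Complex.mul_re, Complex.add_re]
  ring

/-- **THE RANK-ONE NORMALISING FACTOR `b₁^U(s′) = L^U(2s′ + 1, ε_{L∕L⁺})` READ AT `s′ = s + ½` IS HOLOMORPHIC ON `{0 < re s}`** (indeed on `{−½ < re s}`): an absolutely convergent
Euler product, ★ `differentiableOn_partialStandardL_singleton` on `re > 1` (`‖ε(ϖ_v)‖ ≤ 1`: `ε_{L∕L⁺}` has finite order ★ `isFiniteOrder_quadraticHeckeCharCM`, ★ `norm_valueAtUniformizer_le_one`) composed with `s ↦ 2(s + ½) + 1`, `re = 2 re s + 2`.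
[cite: KudlaRallis1994, §1] [cite: Liu2011, §2A (2-2)] -/
theorem differentiableOn_lineL (U : Set (HeightOneSpectrum (𝓞 ↥(maximalRealSubfield L)))) :
    DifferentiableOn ℂ (fun s : ℂ => partialStandardL U (fun v => {(quadraticHeckeCharCM L).valueAtUniformizer v}) (2 * (s + 1 / 2) + 1))
      {s : ℂ | 0 < s.re} :=
  (differentiableOn_partialStandardL_singleton _ (norm_valueAtUniformizer_le_one
    (Literature.RepresentationTheory.HarrisKudlaSweet1996.isFiniteOrder_quadraticHeckeCharCM (L := L)).isUnitary U)).comp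
    (((differentiableOn_const _).mul (differentiableOn_id.add (differentiableOn_const _))).add (differentiableOn_const _))
    fun s hs => by
      have hs' : 0 < s.re := hs
      show 1 < (2 * (s + 1 / 2) + 1).re
      rw [re_lineShift]; linarith

/-- **… AND ZERO-FREE THERE** (★ `hasProd_partialStandardL_singleton`: an absolutely convergent Euler product does not vanish). [cite: KudlaRallis1994, §1] -/
theorem lineL_ne_zero (U : Set (HeightOneSpectrum (𝓞 ↥(maximalRealSubfield L)))) {s : ℂ} (hs : 0 < s.re) :
    partialStandardL U (fun v => {(quadraticHeckeCharCM L).valueAtUniformizer v}) (2 * (s + 1 / 2) + 1) ≠ 0 :=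
  (hasProd_partialStandardL_singleton _ (norm_valueAtUniformizer_le_one
    (Literature.RepresentationTheory.HarrisKudlaSweet1996.isFiniteOrder_quadraticHeckeCharCM (L := L)).isUnitary U)
    (show 1 < (2 * (s + 1 / 2) + 1).re by rw [re_lineShift]; linarith)).2

/-- **THE KEY FACT OF THE ORGAN (one index, one point).**  `W, A : ℂ → ℂ` and a set of places `U`; if `s ↦ W s` is holomorphic on `{0 < re s}` and on that window
`W s = A s · (L^U(2(s+½)+1, ε))⁻¹` (the ONE-FACTOR rank-one Euler identity at inner parameter `s + ½`), then `s ↦ A s` is holomorphic on `{0 < re s}`: `A = W · L^U` there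
(`L^U ≠ 0`, `lineL_ne_zero`) and `L^U` is holomorphic (`differentiableOn_lineL`).  No continuation: at `n = 1` Godement's half-plane `{½ < re s′}` is the whole window.
[cite: MoeglinWaldspurger1995, II.1.7, IV.1.9] [cite: KudlaRallis1994, §1–§2] [cite: Tan1999, §3] -/
theorem differentiableOn_linePart_of_euler (U : Set (HeightOneSpectrum (𝓞 ↥(maximalRealSubfield L)))) {W A : ℂ → ℂ}
    (hW : DifferentiableOn ℂ W {s : ℂ | 0 < s.re})
    (hEuler : ∀ s : ℂ, 0 < s.re → W s = A s * (partialStandardL U (fun v => {(quadraticHeckeCharCM L).valueAtUniformizer v}) (2 * (s + 1 / 2) + 1))⁻¹) :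
    DifferentiableOn ℂ A {s : ℂ | 0 < s.re} := by
  refine (hW.mul (differentiableOn_lineL L U)).congr fun s hs => ?_
  have hs' : 0 < s.re := hs
  have hL := lineL_ne_zero L U hs'
  show A s = W s * partialStandardL U (fun v => {(quadraticHeckeCharCM L).valueAtUniformizer v}) (2 * (s + 1 / 2) + 1)
  rw [hEuler s hs', inv_mul_cancel_right₀ hL]

variable {N₁ M₁ : ℕ} (e₁ : Fin N₁ × Fin M₁ ≃ Fin 1)
  (d₁ : Fin N₁ → L) (hd₁ : ∀ i, IsCMField.complexConj L (d₁ i) = d₁ i) (w₁ : Fin M₁ → L) (hw₁ : ∀ i, IsCMField.complexConj L (w₁ i) = w₁ i)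

/-- **THE `hAd₁` LETTER OF THE BLOCK** — for an index-and-point family: `A₁ : ι → ℂ → X → ℂ` with the KIND-W convention `hdet0` (`A₁ μ s x = 0` whenever `det μ = 0`), the
Euler identity `hEuler₁` against a holomorphic `W₁ μ x` on `{0 < re s}` at the non-degenerate indices ⇒ `s ↦ A₁ μ s x` is holomorphic on `{0 < re s}` for EVERY `μ`, `x`
(degenerate indices: the zero function). [cite: MoeglinWaldspurger1995, IV.1.9] [cite: KudlaRallis1994, §1–§2] -/
theorem differentiableOn_linePart {ι X : Type*} (mat : ι → Matrix (Fin 1) (Fin 1) L) (W₁ A₁ : ι → ℂ → X → ℂ)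
    (U₁ : ι → X → Set (HeightOneSpectrum (𝓞 ↥(maximalRealSubfield L))))
    (hW₁ : ∀ (μ : ι) (x : X), (mat μ).det ≠ 0 → DifferentiableOn ℂ (fun s => W₁ μ s x) {s : ℂ | 0 < s.re})
    (hEuler₁ : ∀ μ : ι, (mat μ).det ≠ 0 → ∀ (s : ℂ) (x : X), 0 < s.re →
      W₁ μ s x = A₁ μ s x * (partialStandardL (U₁ μ x) (fun v => {(quadraticHeckeCharCM L).valueAtUniformizer v}) (2 * (s + 1 / 2) + 1))⁻¹)
    (hdet0 : ∀ (μ : ι) (s : ℂ) (x : X), (mat μ).det = 0 → A₁ μ s x = 0) (μ : ι) (x : X) :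
    DifferentiableOn ℂ (fun s => A₁ μ s x) {s : ℂ | 0 < s.re} := by
  by_cases hdet : (mat μ).det = 0
  · have h0 : (fun s => A₁ μ s x) = fun _ => (0 : ℂ) := funext fun s => hdet0 μ s x hdet
    rw [h0]
    exact differentiableOn_const _
  · exact differentiableOn_linePart_of_euler L (U₁ μ x) (W := fun s => W₁ μ s x) (A := fun s => A₁ μ s x) (hW₁ μ x hdet)
      fun s hs => hEuler₁ μ hdet s x hs

end KeyFact

/-! ## §2 The ∃-package head from the TOP-shape letters (STAGE 1, currency-free) -/

section Package

variable (L : Type) [Field L] [NumberField L] [IsCMField L]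
variable {N₁ M₁ : ℕ} (e₁ : Fin N₁ × Fin M₁ ≃ Fin 1)
  (d₁ : Fin N₁ → L) (hd₁ : ∀ i, IsCMField.complexConj L (d₁ i) = d₁ i) (w₁ : Fin M₁ → L) (hw₁ : ∀ i, IsCMField.complexConj L (w₁ i) = w₁ i)

/-- **KIND W AT `n := 1` — THE ∃-PACKAGE HEAD, STAGE 1 «THE LETTERS GIVE THE BLOCK».**  Line datum `(e₁ : Fin N₁ × Fin M₁ ≃ Fin 1, d₁, w₁)`, a measure `ν₁` on `N_Δ⁽¹⁾(𝔸)`, an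
ABSTRACT `X`-indexed family of line families `Φ : X → ℂ → H₁(𝔸) → ℂ` with a height reading `ht : X → GL_N(𝔸_L)` (assembly: `X := H(𝔸)`, the translate `g`, `ht := (↑)`,
`N := n + n`).  BY VALUE: the Euler data `(A₁, U₁)` with the ONE-FACTOR rank-one identity `hEuler₁` at inner parameter `s + ½` on the whole window `{0 < re s}` (point `1`);
the KIND-W convention `hdet0`; the holomorphy `hW₁` of `s ↦ W⁽¹⁾_μ(Φ_x s)(1)` at the non-degenerate indices (★ (KW1-a)); the size `(τ₁, hτ₁)`, the decay `(NW₁, hdec₁)` and the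
support `(CW₁, κ₁, hCW₁, hκ₁, hsupp₁)` in the TOP's shapes.  THEN the block — conjuncts = TOP ★ ed. 16 :200–220 in order at `n := 1`:
`∃ A₁ U₁, hEuler₁ ∧ hAd₁ ∧ ∃ τ₁ NW₁, hτ₁ ∧ hdec₁ ∧ ∃ CW₁ κ₁, 0 < CW₁ ∧ 0 ≤ κ₁ ∧ hsupp₁`, with `hAd₁` by §1.
[cite: MoeglinWaldspurger1995, II.1.7, IV.1.9] [cite: KudlaRallis1994, §1–§2] [cite: Tan1999, §3, §4 Prop. 4.8] [cite: Shimura1997, §18.4 Prop. 18.14] [cite: BorelJacquet1979, §1.2] -/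
theorem exists_kindW_line_letters_of_letters
    [MeasurableSpace (unipDelta L e₁ d₁ hd₁ w₁ hw₁)] (ν₁ : Measure (unipDelta L e₁ d₁ hd₁ w₁ hw₁))
    {X : Type*} {N : ℕ} (ht : X → GL (Fin N) (AdeleRing (𝓞 L) L)) (Φ : X → ℂ → HA L e₁ d₁ hd₁ w₁ hw₁ → ℂ)
    -- (W1) the Euler data BY VALUE: `T`-part, exceptional places, ONE-FACTOR identity at `s′ = s + ½` on `{0 < re s}`, point `1`
    (A₁ : skewMatrices ((IsCMField.complexConj L : L ≃ₐ[Fp L] L) : L →+* L) ((gramR L e₁ d₁ hd₁ w₁ hw₁).map (algebraMap (Fp L) L)) → ℂ → X → ℂ)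
    (U₁ : skewMatrices ((IsCMField.complexConj L : L ≃ₐ[Fp L] L) : L →+* L) ((gramR L e₁ d₁ hd₁ w₁ hw₁).map (algebraMap (Fp L) L)) → X →
      Set (HeightOneSpectrum (𝓞 ↥(maximalRealSubfield L))))
    (hEuler₁ : ∀ μ : skewMatrices ((IsCMField.complexConj L : L ≃ₐ[Fp L] L) : L →+* L) ((gramR L e₁ d₁ hd₁ w₁ hw₁).map (algebraMap (Fp L) L)),
      (μ : Matrix (Fin 1) (Fin 1) L).det ≠ 0 → ∀ (s : ℂ) (x : X), 0 < s.re →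
        whittakerDelta L e₁ d₁ hd₁ w₁ hw₁ ν₁ (μ : Matrix (Fin 1) (Fin 1) L) (Φ x s) 1 =
          A₁ μ s x * (partialStandardL (U₁ μ x) (fun v => {(quadraticHeckeCharCM L).valueAtUniformizer v}) (2 * (s + 1 / 2) + 1))⁻¹)
    -- the KIND-W convention at the degenerate indices
    (hdet0 : ∀ (μ : skewMatrices ((IsCMField.complexConj L : L ≃ₐ[Fp L] L) : L →+* L) ((gramR L e₁ d₁ hd₁ w₁ hw₁).map (algebraMap (Fp L) L)))
      (s : ℂ) (x : X), (μ : Matrix (Fin 1) (Fin 1) L).det = 0 → A₁ μ s x = 0)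
    -- (W2) input: the rank-one Whittaker integral is holomorphic on the whole window (★ (KW1-a))
    (hW₁ : ∀ (μ : skewMatrices ((IsCMField.complexConj L : L ≃ₐ[Fp L] L) : L →+* L) ((gramR L e₁ d₁ hd₁ w₁ hw₁).map (algebraMap (Fp L) L))) (x : X),
      (μ : Matrix (Fin 1) (Fin 1) L).det ≠ 0 →
        DifferentiableOn ℂ (fun s => whittakerDelta L e₁ d₁ hd₁ w₁ hw₁ ν₁ (μ : Matrix (Fin 1) (Fin 1) L) (Φ x s) 1) {s : ℂ | 0 < s.re})
    -- (W3) BY VALUE in the TOP's shapes: size, decay, support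
    (τ₁ : skewMatrices ((IsCMField.complexConj L : L ≃ₐ[Fp L] L) : L →+* L) ((gramR L e₁ d₁ hd₁ w₁ hw₁).map (algebraMap (Fp L) L)) → ℝ)
    (hτ₁ : ∀ μ : skewMatrices ((IsCMField.complexConj L : L ≃ₐ[Fp L] L) : L →+* L) ((gramR L e₁ d₁ hd₁ w₁ hw₁).map (algebraMap (Fp L) L)),
      ‖(fun i j => NumberField.mixedEmbedding L ((μ : Matrix (Fin 1) (Fin 1) L) i j))‖ ≤ τ₁ μ) (NW₁ : ℕ)
    (hdec₁ : ∀ z : ℂ, 0 < z.re → ∃ C a c a' r : ℝ, 0 ≤ C ∧ 0 ≤ a ∧ 0 < c ∧ 0 ≤ a' ∧ 0 < r ∧ ∀ μ (s : ℂ), dist s z < r → ∀ x : X,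
      ‖A₁ μ s x‖ ≤ C * adelicHeightGL N L (ht x) ^ a * (Real.exp (-(c * adelicHeightGL N L (ht x) ^ (-a') * τ₁ μ)) * (1 + τ₁ μ) ^ NW₁))
    {CW₁ κ₁ : ℝ} (hCW₁ : 0 < CW₁) (hκ₁ : 0 ≤ κ₁)
    (hsupp₁ : ∀ μ (s : ℂ) (x : X), 0 < s.re → A₁ μ s x ≠ 0 →
      ∃ D : ℕ, 1 ≤ D ∧ (D : ℝ) ≤ CW₁ * adelicHeightGL N L (ht x) ^ κ₁ ∧ ∀ i j, IsIntegral ℤ ((D : L) * (μ : Matrix (Fin 1) (Fin 1) L) i j)) :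
    ∃ (A₁ : skewMatrices ((IsCMField.complexConj L : L ≃ₐ[Fp L] L) : L →+* L) ((gramR L e₁ d₁ hd₁ w₁ hw₁).map (algebraMap (Fp L) L)) → ℂ → X → ℂ)
      (U₁ : skewMatrices ((IsCMField.complexConj L : L ≃ₐ[Fp L] L) : L →+* L) ((gramR L e₁ d₁ hd₁ w₁ hw₁).map (algebraMap (Fp L) L)) → X →
        Set (HeightOneSpectrum (𝓞 ↥(maximalRealSubfield L)))),
      (∀ μ : skewMatrices ((IsCMField.complexConj L : L ≃ₐ[Fp L] L) : L →+* L) ((gramR L e₁ d₁ hd₁ w₁ hw₁).map (algebraMap (Fp L) L)),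
        (μ : Matrix (Fin 1) (Fin 1) L).det ≠ 0 → ∀ (s : ℂ) (x : X), 0 < s.re →
          whittakerDelta L e₁ d₁ hd₁ w₁ hw₁ ν₁ (μ : Matrix (Fin 1) (Fin 1) L) (Φ x s) 1 =
            A₁ μ s x * (partialStandardL (U₁ μ x) (fun v => {(quadraticHeckeCharCM L).valueAtUniformizer v}) (2 * (s + 1 / 2) + 1))⁻¹) ∧
      (∀ μ (x : X), DifferentiableOn ℂ (fun s => A₁ μ s x) {s : ℂ | 0 < s.re}) ∧
      ∃ (τ₁ : skewMatrices ((IsCMField.complexConj L : L ≃ₐ[Fp L] L) : L →+* L) ((gramR L e₁ d₁ hd₁ w₁ hw₁).map (algebraMap (Fp L) L)) → ℝ) (NW₁ : ℕ),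
        (∀ μ : skewMatrices ((IsCMField.complexConj L : L ≃ₐ[Fp L] L) : L →+* L) ((gramR L e₁ d₁ hd₁ w₁ hw₁).map (algebraMap (Fp L) L)),
          ‖(fun i j => NumberField.mixedEmbedding L ((μ : Matrix (Fin 1) (Fin 1) L) i j))‖ ≤ τ₁ μ) ∧
        (∀ z : ℂ, 0 < z.re → ∃ C a c a' r : ℝ, 0 ≤ C ∧ 0 ≤ a ∧ 0 < c ∧ 0 ≤ a' ∧ 0 < r ∧ ∀ μ (s : ℂ), dist s z < r → ∀ x : X,
          ‖A₁ μ s x‖ ≤ C * adelicHeightGL N L (ht x) ^ a * (Real.exp (-(c * adelicHeightGL N L (ht x) ^ (-a') * τ₁ μ)) * (1 + τ₁ μ) ^ NW₁)) ∧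
        ∃ CW₁ κ₁ : ℝ, 0 < CW₁ ∧ 0 ≤ κ₁ ∧
          ∀ μ (s : ℂ) (x : X), 0 < s.re → A₁ μ s x ≠ 0 →
            ∃ D : ℕ, 1 ≤ D ∧ (D : ℝ) ≤ CW₁ * adelicHeightGL N L (ht x) ^ κ₁ ∧ ∀ i j, IsIntegral ℤ ((D : L) * (μ : Matrix (Fin 1) (Fin 1) L) i j) :=
  ⟨A₁, U₁, hEuler₁,
    differentiableOn_linePart L
      (fun μ : skewMatrices ((IsCMField.complexConj L : L ≃ₐ[Fp L] L) : L →+* L) ((gramR L e₁ d₁ hd₁ w₁ hw₁).map (algebraMap (Fp L) L)) =>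
        (μ : Matrix (Fin 1) (Fin 1) L))
      (fun μ s x => whittakerDelta L e₁ d₁ hd₁ w₁ hw₁ ν₁ (μ : Matrix (Fin 1) (Fin 1) L) (Φ x s) 1) A₁ U₁ hW₁ hEuler₁ hdet0,
    τ₁, NW₁, hτ₁, hdec₁, CW₁, κ₁, hCW₁, hκ₁, hsupp₁⟩

/-- **THE SAME, `hW₁` BY NAME FROM THE FOUR LETTERS OF ★ (KW1-a)** `differentiableOn_whittakerDelta_line_of_envelope`: per index `x`, `Φ x` is a family of Siegel sections of
`I⁽¹⁾(s + ½, χ)` (`χ` unitary), holomorphic in `s` on `{0 < re s}` pointwise, continuous, with a vertical-strip envelope on every strip of `{0 < re s}`; `ν₁` Haar; `d₁ w₁ ≠ 0` —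
exactly (KW1-e)'s ★ letters for the corner family `Φ^{(p₀,g)}` (★ `isSiegelDeltaSection_cornerTranslate`, `differentiableOn_∕continuous_cornerTranslate`, envelope by ★ (KW1-a)
§2 (c) `envelope_of_norm_eq_mul` over `norm_cornerTranslate_eq`).  THEN the block of `exists_kindW_line_letters_of_letters`.
[cite: KudlaRallis1994, §1–§2] [cite: MoeglinWaldspurger1995, II.1.7, IV.1.9] [cite: Tan1999, §3] -/
theorem exists_kindW_line_letters_of_envelope
    [MeasurableSpace (unipDelta L e₁ d₁ hd₁ w₁ hw₁)] [BorelSpace (unipDelta L e₁ d₁ hd₁ w₁ hw₁)]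
    (hd0 : ∀ i, d₁ i ≠ 0) (hw0 : ∀ i, w₁ i ≠ 0) {χ : HeckeCharacter L} (hχ : χ.IsUnitary)
    (ν₁ : Measure (unipDelta L e₁ d₁ hd₁ w₁ hw₁)) [ν₁.IsHaarMeasure]
    {X : Type*} {N : ℕ} (ht : X → GL (Fin N) (AdeleRing (𝓞 L) L)) (Φ : X → ℂ → HA L e₁ d₁ hd₁ w₁ hw₁ → ℂ)
    -- the four letters of ★ (KW1-a), per index
    (hsec : ∀ (x : X) (s : ℂ), IsSiegelDeltaSection L e₁ d₁ hd₁ w₁ hw₁ χ (s + 1 / 2) (Φ x s))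
    (hhol : ∀ (x : X) (y : HA L e₁ d₁ hd₁ w₁ hw₁), DifferentiableOn ℂ (fun s => Φ x s y) {s : ℂ | 0 < s.re})
    (hcont : ∀ (x : X) (s : ℂ), Continuous (Φ x s))
    (henv : ∀ (x : X) (σ₀ σ₁ : ℝ), 0 < σ₀ → σ₀ ≤ σ₁ → ∃ C : ℝ, ∀ s : ℂ, σ₀ ≤ s.re → s.re ≤ σ₁ →
      ∀ y : HA L e₁ d₁ hd₁ w₁ hw₁, ‖Φ x s y‖ ≤ C * (‖Φ x (σ₀ : ℂ) y‖ + ‖Φ x (σ₁ : ℂ) y‖))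
    -- (W1) by value, `hdet0`, (W3) by value — as in `exists_kindW_line_letters_of_letters`
    (A₁ : skewMatrices ((IsCMField.complexConj L : L ≃ₐ[Fp L] L) : L →+* L) ((gramR L e₁ d₁ hd₁ w₁ hw₁).map (algebraMap (Fp L) L)) → ℂ → X → ℂ)
    (U₁ : skewMatrices ((IsCMField.complexConj L : L ≃ₐ[Fp L] L) : L →+* L) ((gramR L e₁ d₁ hd₁ w₁ hw₁).map (algebraMap (Fp L) L)) → X →
      Set (HeightOneSpectrum (𝓞 ↥(maximalRealSubfield L))))
    (hEuler₁ : ∀ μ : skewMatrices ((IsCMField.complexConj L : L ≃ₐ[Fp L] L) : L →+* L) ((gramR L e₁ d₁ hd₁ w₁ hw₁).map (algebraMap (Fp L) L)),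
      (μ : Matrix (Fin 1) (Fin 1) L).det ≠ 0 → ∀ (s : ℂ) (x : X), 0 < s.re →
        whittakerDelta L e₁ d₁ hd₁ w₁ hw₁ ν₁ (μ : Matrix (Fin 1) (Fin 1) L) (Φ x s) 1 =
          A₁ μ s x * (partialStandardL (U₁ μ x) (fun v => {(quadraticHeckeCharCM L).valueAtUniformizer v}) (2 * (s + 1 / 2) + 1))⁻¹)
    (hdet0 : ∀ (μ : skewMatrices ((IsCMField.complexConj L : L ≃ₐ[Fp L] L) : L →+* L) ((gramR L e₁ d₁ hd₁ w₁ hw₁).map (algebraMap (Fp L) L)))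
      (s : ℂ) (x : X), (μ : Matrix (Fin 1) (Fin 1) L).det = 0 → A₁ μ s x = 0)
    (τ₁ : skewMatrices ((IsCMField.complexConj L : L ≃ₐ[Fp L] L) : L →+* L) ((gramR L e₁ d₁ hd₁ w₁ hw₁).map (algebraMap (Fp L) L)) → ℝ)
    (hτ₁ : ∀ μ : skewMatrices ((IsCMField.complexConj L : L ≃ₐ[Fp L] L) : L →+* L) ((gramR L e₁ d₁ hd₁ w₁ hw₁).map (algebraMap (Fp L) L)),
      ‖(fun i j => NumberField.mixedEmbedding L ((μ : Matrix (Fin 1) (Fin 1) L) i j))‖ ≤ τ₁ μ) (NW₁ : ℕ)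
    (hdec₁ : ∀ z : ℂ, 0 < z.re → ∃ C a c a' r : ℝ, 0 ≤ C ∧ 0 ≤ a ∧ 0 < c ∧ 0 ≤ a' ∧ 0 < r ∧ ∀ μ (s : ℂ), dist s z < r → ∀ x : X,
      ‖A₁ μ s x‖ ≤ C * adelicHeightGL N L (ht x) ^ a * (Real.exp (-(c * adelicHeightGL N L (ht x) ^ (-a') * τ₁ μ)) * (1 + τ₁ μ) ^ NW₁))
    {CW₁ κ₁ : ℝ} (hCW₁ : 0 < CW₁) (hκ₁ : 0 ≤ κ₁)
    (hsupp₁ : ∀ μ (s : ℂ) (x : X), 0 < s.re → A₁ μ s x ≠ 0 →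
      ∃ D : ℕ, 1 ≤ D ∧ (D : ℝ) ≤ CW₁ * adelicHeightGL N L (ht x) ^ κ₁ ∧ ∀ i j, IsIntegral ℤ ((D : L) * (μ : Matrix (Fin 1) (Fin 1) L) i j)) :
    ∃ (A₁ : skewMatrices ((IsCMField.complexConj L : L ≃ₐ[Fp L] L) : L →+* L) ((gramR L e₁ d₁ hd₁ w₁ hw₁).map (algebraMap (Fp L) L)) → ℂ → X → ℂ)
      (U₁ : skewMatrices ((IsCMField.complexConj L : L ≃ₐ[Fp L] L) : L →+* L) ((gramR L e₁ d₁ hd₁ w₁ hw₁).map (algebraMap (Fp L) L)) → X →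
        Set (HeightOneSpectrum (𝓞 ↥(maximalRealSubfield L)))),
      (∀ μ : skewMatrices ((IsCMField.complexConj L : L ≃ₐ[Fp L] L) : L →+* L) ((gramR L e₁ d₁ hd₁ w₁ hw₁).map (algebraMap (Fp L) L)),
        (μ : Matrix (Fin 1) (Fin 1) L).det ≠ 0 → ∀ (s : ℂ) (x : X), 0 < s.re →
          whittakerDelta L e₁ d₁ hd₁ w₁ hw₁ ν₁ (μ : Matrix (Fin 1) (Fin 1) L) (Φ x s) 1 =
            A₁ μ s x * (partialStandardL (U₁ μ x) (fun v => {(quadraticHeckeCharCM L).valueAtUniformizer v}) (2 * (s + 1 / 2) + 1))⁻¹) ∧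
      (∀ μ (x : X), DifferentiableOn ℂ (fun s => A₁ μ s x) {s : ℂ | 0 < s.re}) ∧
      ∃ (τ₁ : skewMatrices ((IsCMField.complexConj L : L ≃ₐ[Fp L] L) : L →+* L) ((gramR L e₁ d₁ hd₁ w₁ hw₁).map (algebraMap (Fp L) L)) → ℝ) (NW₁ : ℕ),
        (∀ μ : skewMatrices ((IsCMField.complexConj L : L ≃ₐ[Fp L] L) : L →+* L) ((gramR L e₁ d₁ hd₁ w₁ hw₁).map (algebraMap (Fp L) L)),
          ‖(fun i j => NumberField.mixedEmbedding L ((μ : Matrix (Fin 1) (Fin 1) L) i j))‖ ≤ τ₁ μ) ∧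
        (∀ z : ℂ, 0 < z.re → ∃ C a c a' r : ℝ, 0 ≤ C ∧ 0 ≤ a ∧ 0 < c ∧ 0 ≤ a' ∧ 0 < r ∧ ∀ μ (s : ℂ), dist s z < r → ∀ x : X,
          ‖A₁ μ s x‖ ≤ C * adelicHeightGL N L (ht x) ^ a * (Real.exp (-(c * adelicHeightGL N L (ht x) ^ (-a') * τ₁ μ)) * (1 + τ₁ μ) ^ NW₁)) ∧
        ∃ CW₁ κ₁ : ℝ, 0 < CW₁ ∧ 0 ≤ κ₁ ∧
          ∀ μ (s : ℂ) (x : X), 0 < s.re → A₁ μ s x ≠ 0 →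
            ∃ D : ℕ, 1 ≤ D ∧ (D : ℝ) ≤ CW₁ * adelicHeightGL N L (ht x) ^ κ₁ ∧ ∀ i j, IsIntegral ℤ ((D : L) * (μ : Matrix (Fin 1) (Fin 1) L) i j) :=
  exists_kindW_line_letters_of_letters L e₁ d₁ hd₁ w₁ hw₁ ν₁ ht Φ A₁ U₁ hEuler₁ hdet0
    (fun μ x _ => differentiableOn_whittakerDelta_line_of_envelope L e₁ d₁ hd₁ w₁ hw₁ hd0 hw0 hχ (hsec x) (hhol x) (hcont x) (henv x) ν₁
      (μ : Matrix (Fin 1) (Fin 1) L) 1)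
    τ₁ hτ₁ NW₁ hdec₁ hCW₁ hκ₁ hsupp₁

end Package

/-! ## §3 The ∃-package head from the LOCAL letters (S-loc), (D-loc) — the `n = 2` STAGE 1 (★ `K2LiuSiegelEisensteinKindWPackage`) one rank down -/

section Local

variable (L : Type) [Field L] [NumberField L] [IsCMField L]
variable {N₁ M₁ : ℕ} (e₁ : Fin N₁ × Fin M₁ ≃ Fin 1)
  (d₁ : Fin N₁ → L) (hd₁ : ∀ i, IsCMField.complexConj L (d₁ i) = d₁ i) (w₁ : Fin M₁ → L) (hw₁ : ∀ i, IsCMField.complexConj L (w₁ i) = w₁ i)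

/-- **KIND W AT `n := 1` — THE ∃-PACKAGE HEAD FROM THE LOCAL LETTERS.**  As `exists_kindW_line_letters_of_letters`, but the (W3) letters enter in the LOCAL currencies:
**(S-loc)** the global lattice letter of ★ `hsupp_of_local` — `A₁ μ s x ≠ 0 ⇒ ∀ w, ∃ m, q_w^m ≤ q_w^{δ_w} · H_w(ht x)^k ∧ |μ_{ab}|_w ≤ exp m` (defect datum `(T_δ, δ)`, exponent
`k`); **(D-loc)** the global decay letter of ★ `hdec_of_letters` — the TOP's decay shape at `τ₁ μ := ‖(ι_∞ μ_{ab})_{ab}‖` TIMES the archimedean determinant defect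
`∏_{w∣∞}(1 + |det μ|_w⁻¹)^{N′}` (exponents `N₁ N′`).  THEN the block, with `τ₁ μ := ‖(ι_∞ μ_{ab})_{ab}‖`, `hτ₁ := le_rfl`, `hsupp₁` by ★ `hsupp_of_local`, `hdec₁` by ★ `hdec_of_letters`
(both ★ generic in `(ι, X, n, N)`, read at `n := 1`, `mat := (↑)`), `hAd₁` by §1.  `N ≠ 0` (heights on `GL_N`).
[cite: MoeglinWaldspurger1995, II.1.7, IV.1.9] [cite: KudlaRallis1994, §1] [cite: Tan1999, §4 Prop. 4.8] [cite: Shimura1997, §18.4 Prop. 18.14] [cite: BorelJacquet1979, §1.2] -/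
theorem exists_kindW_line_letters_of_localLetters
    [MeasurableSpace (unipDelta L e₁ d₁ hd₁ w₁ hw₁)] (ν₁ : Measure (unipDelta L e₁ d₁ hd₁ w₁ hw₁))
    {X : Type*} {N : ℕ} [NeZero N] (ht : X → GL (Fin N) (AdeleRing (𝓞 L) L)) (Φ : X → ℂ → HA L e₁ d₁ hd₁ w₁ hw₁ → ℂ)
    -- (W1) the Euler data BY VALUE
    (A₁ : skewMatrices ((IsCMField.complexConj L : L ≃ₐ[Fp L] L) : L →+* L) ((gramR L e₁ d₁ hd₁ w₁ hw₁).map (algebraMap (Fp L) L)) → ℂ → X → ℂ)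
    (U₁ : skewMatrices ((IsCMField.complexConj L : L ≃ₐ[Fp L] L) : L →+* L) ((gramR L e₁ d₁ hd₁ w₁ hw₁).map (algebraMap (Fp L) L)) → X →
      Set (HeightOneSpectrum (𝓞 ↥(maximalRealSubfield L))))
    (hEuler₁ : ∀ μ : skewMatrices ((IsCMField.complexConj L : L ≃ₐ[Fp L] L) : L →+* L) ((gramR L e₁ d₁ hd₁ w₁ hw₁).map (algebraMap (Fp L) L)),
      (μ : Matrix (Fin 1) (Fin 1) L).det ≠ 0 → ∀ (s : ℂ) (x : X), 0 < s.re →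
        whittakerDelta L e₁ d₁ hd₁ w₁ hw₁ ν₁ (μ : Matrix (Fin 1) (Fin 1) L) (Φ x s) 1 =
          A₁ μ s x * (partialStandardL (U₁ μ x) (fun v => {(quadraticHeckeCharCM L).valueAtUniformizer v}) (2 * (s + 1 / 2) + 1))⁻¹)
    (hdet0 : ∀ (μ : skewMatrices ((IsCMField.complexConj L : L ≃ₐ[Fp L] L) : L →+* L) ((gramR L e₁ d₁ hd₁ w₁ hw₁).map (algebraMap (Fp L) L)))
      (s : ℂ) (x : X), (μ : Matrix (Fin 1) (Fin 1) L).det = 0 → A₁ μ s x = 0)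
    -- (W2) input (★ (KW1-a))
    (hW₁ : ∀ (μ : skewMatrices ((IsCMField.complexConj L : L ≃ₐ[Fp L] L) : L →+* L) ((gramR L e₁ d₁ hd₁ w₁ hw₁).map (algebraMap (Fp L) L))) (x : X),
      (μ : Matrix (Fin 1) (Fin 1) L).det ≠ 0 →
        DifferentiableOn ℂ (fun s => whittakerDelta L e₁ d₁ hd₁ w₁ hw₁ ν₁ (μ : Matrix (Fin 1) (Fin 1) L) (Φ x s) 1) {s : ℂ | 0 < s.re})
    -- (S-loc): the global lattice letter (places `w` of `L`; defect datum `(T_δ, δ)`, exponent `k`)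
    (Tδ : Finset (HeightOneSpectrum (𝓞 L))) (δ : HeightOneSpectrum (𝓞 L) → ℕ) (hδ : ∀ w ∉ Tδ, δ w = 0) (k : ℕ)
    (hSloc : ∀ (μ : skewMatrices ((IsCMField.complexConj L : L ≃ₐ[Fp L] L) : L →+* L) ((gramR L e₁ d₁ hd₁ w₁ hw₁).map (algebraMap (Fp L) L)))
      (s : ℂ) (x : X), 0 < s.re → A₁ μ s x ≠ 0 → ∀ w : HeightOneSpectrum (𝓞 L), ∃ m : ℕ,
        ((Ideal.absNorm w.asIdeal : ℕ) : ℝ) ^ m ≤ ((Ideal.absNorm w.asIdeal : ℕ) : ℝ) ^ δ w * (GLn.localHeight N L w (ht x) : ℝ) ^ k ∧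
          ∀ a b, Valued.v ((((μ : Matrix (Fin 1) (Fin 1) L) a b : L)) : w.adicCompletion L) ≤ WithZero.exp (m : ℤ))
    -- (D-loc): the global decay letter carrying the archimedean determinant defect
    (N₁' N' : ℕ)
    (hDloc : ∀ z : ℂ, 0 < z.re → ∃ C a c a' r : ℝ, 0 ≤ C ∧ 0 ≤ a ∧ 0 < c ∧ 0 ≤ a' ∧ 0 < r ∧
      ∀ (μ : skewMatrices ((IsCMField.complexConj L : L ≃ₐ[Fp L] L) : L →+* L) ((gramR L e₁ d₁ hd₁ w₁ hw₁).map (algebraMap (Fp L) L))) (s : ℂ),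
        dist s z < r → ∀ x : X,
        ‖A₁ μ s x‖ ≤ C * adelicHeightGL N L (ht x) ^ a *
          (Real.exp (-(c * adelicHeightGL N L (ht x) ^ (-a') * ‖(fun i j => NumberField.mixedEmbedding L ((μ : Matrix (Fin 1) (Fin 1) L) i j))‖)) *
            (1 + ‖(fun i j => NumberField.mixedEmbedding L ((μ : Matrix (Fin 1) (Fin 1) L) i j))‖) ^ N₁') *
          ∏ w : InfinitePlace L, (1 + (w (μ : Matrix (Fin 1) (Fin 1) L).det)⁻¹) ^ N') :
    ∃ (A₁ : skewMatrices ((IsCMField.complexConj L : L ≃ₐ[Fp L] L) : L →+* L) ((gramR L e₁ d₁ hd₁ w₁ hw₁).map (algebraMap (Fp L) L)) → ℂ → X → ℂ)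
      (U₁ : skewMatrices ((IsCMField.complexConj L : L ≃ₐ[Fp L] L) : L →+* L) ((gramR L e₁ d₁ hd₁ w₁ hw₁).map (algebraMap (Fp L) L)) → X →
        Set (HeightOneSpectrum (𝓞 ↥(maximalRealSubfield L)))),
      (∀ μ : skewMatrices ((IsCMField.complexConj L : L ≃ₐ[Fp L] L) : L →+* L) ((gramR L e₁ d₁ hd₁ w₁ hw₁).map (algebraMap (Fp L) L)),
        (μ : Matrix (Fin 1) (Fin 1) L).det ≠ 0 → ∀ (s : ℂ) (x : X), 0 < s.re →
          whittakerDelta L e₁ d₁ hd₁ w₁ hw₁ ν₁ (μ : Matrix (Fin 1) (Fin 1) L) (Φ x s) 1 =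
            A₁ μ s x * (partialStandardL (U₁ μ x) (fun v => {(quadraticHeckeCharCM L).valueAtUniformizer v}) (2 * (s + 1 / 2) + 1))⁻¹) ∧
      (∀ μ (x : X), DifferentiableOn ℂ (fun s => A₁ μ s x) {s : ℂ | 0 < s.re}) ∧
      ∃ (τ₁ : skewMatrices ((IsCMField.complexConj L : L ≃ₐ[Fp L] L) : L →+* L) ((gramR L e₁ d₁ hd₁ w₁ hw₁).map (algebraMap (Fp L) L)) → ℝ) (NW₁ : ℕ),
        (∀ μ : skewMatrices ((IsCMField.complexConj L : L ≃ₐ[Fp L] L) : L →+* L) ((gramR L e₁ d₁ hd₁ w₁ hw₁).map (algebraMap (Fp L) L)),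
          ‖(fun i j => NumberField.mixedEmbedding L ((μ : Matrix (Fin 1) (Fin 1) L) i j))‖ ≤ τ₁ μ) ∧
        (∀ z : ℂ, 0 < z.re → ∃ C a c a' r : ℝ, 0 ≤ C ∧ 0 ≤ a ∧ 0 < c ∧ 0 ≤ a' ∧ 0 < r ∧ ∀ μ (s : ℂ), dist s z < r → ∀ x : X,
          ‖A₁ μ s x‖ ≤ C * adelicHeightGL N L (ht x) ^ a * (Real.exp (-(c * adelicHeightGL N L (ht x) ^ (-a') * τ₁ μ)) * (1 + τ₁ μ) ^ NW₁)) ∧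
        ∃ CW₁ κ₁ : ℝ, 0 < CW₁ ∧ 0 ≤ κ₁ ∧
          ∀ μ (s : ℂ) (x : X), 0 < s.re → A₁ μ s x ≠ 0 →
            ∃ D : ℕ, 1 ≤ D ∧ (D : ℝ) ≤ CW₁ * adelicHeightGL N L (ht x) ^ κ₁ ∧ ∀ i j, IsIntegral ℤ ((D : L) * (μ : Matrix (Fin 1) (Fin 1) L) i j) := by
  -- (S-loc) ⟹ `hsupp₁` (★ `hsupp_of_local` at `n := 1`, `mat := (↑)`)
  obtain ⟨CW₁, κ₁, hCW₁, hκ₁, hsupp₁⟩ := hsupp_of_local L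
    (fun μ : skewMatrices ((IsCMField.complexConj L : L ≃ₐ[Fp L] L) : L →+* L) ((gramR L e₁ d₁ hd₁ w₁ hw₁).map (algebraMap (Fp L) L)) =>
      (μ : Matrix (Fin 1) (Fin 1) L)) ht A₁ Tδ δ hδ k hSloc
  -- (D-loc) + `hsupp₁` ⟹ `hdec₁` (★ `hdec_of_letters` at `n := 1`)
  obtain ⟨NW₁, hdec₁⟩ := hdec_of_letters L
    (fun μ : skewMatrices ((IsCMField.complexConj L : L ≃ₐ[Fp L] L) : L →+* L) ((gramR L e₁ d₁ hd₁ w₁ hw₁).map (algebraMap (Fp L) L)) =>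
      (μ : Matrix (Fin 1) (Fin 1) L)) ht A₁
    (fun μ => ‖(fun i j => NumberField.mixedEmbedding L ((μ : Matrix (Fin 1) (Fin 1) L) i j))‖) (fun μ => le_rfl) hdet0 hCW₁ hκ₁ hsupp₁ N₁' N' hDloc
  exact exists_kindW_line_letters_of_letters L e₁ d₁ hd₁ w₁ hw₁ ν₁ ht Φ A₁ U₁ hEuler₁ hdet0 hW₁
    (fun μ => ‖(fun i j => NumberField.mixedEmbedding L ((μ : Matrix (Fin 1) (Fin 1) L) i j))‖) (fun μ => le_rfl) NW₁ hdec₁ hCW₁ hκ₁ hsupp₁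

end Local

end Summit.HodgeConjecture.HodgeConjecture.Cruxes.HLiu418.K2LiuKindOneLineWhittakerPackage

end
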